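import Summits.FinalStateConjecture.FinalStateConjecture.Theses.PhaseMixingCapture
import Summits.FinalStateConjecture.FinalStateConjecture.Theorems.PhaseMixingCaptureAssemblyTameReduction
import Summits.FinalStateConjecture.FinalStateConjecture.Theorems.CaptureSufficesTame.Negative.CounterexampleShape

/-!
# `Assembly` (item `stmt-FinalStateConjecture-14987`, route `PhaseMixingCapture`): structural reductions

The assembly item of route `PhaseMixingCapture` (rev 16, typing ruling 2026-08-16) is the conjunctive,
`CaptureSufficesC2`-free statement

`Assembly := NearExtremalKappaCapture ∧ BulkKerrCaptureC2 ∧ WeakCosmicCensorshipMGHD → FinalStateConjecture`.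

Unlike the route's deciding theorem `closes : NearExtremalKappaCapture → BulkKerrCaptureC2 →
WeakCosmicCensorshipMGHD → CaptureSufficesC2 → FinalStateConjecture` it does NOT take the conditional
crux `CaptureSufficesC2 := NearExtremalKappaCapture → BulkKerrCaptureC2 → WeakCosmicCensorshipMGHD →
FinalStateConjecture` (rank 6, item `stmt-FinalStateConjecture-14986`) as a hypothesis, so it is not
bookkeeping: it is that crux, uncurried. This file records, sorry-free, the logic that pins the item to
the crux:

* `assembly_iff_captureSufficesC2` — `Assembly ↔ CaptureSufficesC2` (currying); hence the item closes
  the moment `stmt-FinalStateConjecture-14986` does (`assembly_of_captureSufficesC2`), and conversely a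
  proof of the item is a proof of the crux (`captureSufficesC2_of_assembly`);
* `assembly_of_finalStateConjecture` — the summit statement implies the item (so `¬ Assembly` would
  refute the summit: the item is not refutable short of that);
* `assembly_iff_closes_hypothesis` — granted the three capture / censorship cruxes, the item is
  equivalent to the summit statement itself (what is left is the whole large-data front end).

No analysis, no new definitions.

**Repair 2026-08-17 (fullbuild breakage "39:31 / 39:60 / 59:22: Application type mismatch").** The
statement revision p126844 (re-type T2) and the route repair of 2026-08-16T23:16Z (rev 18/19) restated
the item UNDER THE SAME DECL NAME: `Assembly := NearExtremalKappaCapture ∧ BulkKerrCaptureC2 ∧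
WeakCosmicCensorshipTame → FinalStateConjecture` (item stmt-FinalStateConjecture-17346; the third
conjunct is now TAME censorship, the summit's own genericity notion, and the matching conditional crux
is `CaptureSufficesTame`, stmt-FinalStateConjecture-17270), while `CaptureSufficesC2` and
`WeakCosmicCensorshipMGHD` stay in the route file as pre-revision supports. Tame genericity forgets to
plain genericity (`PhaseMixingCaptureAssemblyTame.weakCosmicCensorshipMGHD_of_weakCosmicCensorshipTame`)
but not conversely, so of the six records above three survive with new proofs and unchanged statements
(`assembly_of_captureSufficesC2` — the pre-revision crux still closes the re-typed item;
`assembly_of_finalStateConjecture`; `finalStateConjecture_of_cruxes`, now plain modus ponens on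
`CaptureSufficesC2` since `closes` runs over the tame pair), and three became UNDERIVABLE as stated
(`assembly_iff_captureSufficesC2`, `captureSufficesC2_of_assembly`, `assembly_iff_closes_hypothesis`:
each would need plain ⇒ tame genericity). Theorems files are append-only (a recorded declaration is
neither restated nor removed), so those three names are kept as `@[deprecated]` aliases of their
re-typed counterparts — the landed `CaptureSufficesTame.Negative.assembly_iff_captureSufficesTame`
(Theorems/CaptureSufficesTame/Negative/CounterexampleShape.lean),
`PhaseMixingCaptureAssemblyTame.captureSufficesTame_of_assembly`
(Theorems/PhaseMixingCaptureAssemblyTameReduction.lean, the rev-19 successor of this file), and the new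
`assembly_iff_statement_of_tameCruxes` below. Nothing here closes stmt-17346.
-/

-- the doubled `FinalStateConjecture.FinalStateConjecture` path component trips dupNamespace
set_option linter.dupNamespace false

namespace Summit.FinalStateConjecture.FinalStateConjecture.Theorems.PhaseMixingCaptureAssembly

open Summit.FinalStateConjecture.FinalStateConjecture.Theses.PhaseMixingCapture
open Summit.FinalStateConjecture.FinalStateConjecture.Theorems.PhaseMixingCaptureAssemblyTame
  (weakCosmicCensorshipMGHD_of_weakCosmicCensorshipTame)

/-- **Deprecated record.** Formerly `Assembly ↔ CaptureSufficesC2` (rev-16 item stmt-14987 ↔ crux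
stmt-14986, currying); since the tame re-typing of `Assembly` (stmt-17346) the matching conditional crux
is `CaptureSufficesTame` (stmt-17270) and the `iff` over plain genericity is underivable, so the name is
kept as an alias of the landed tame `iff`. [folklore] -/
@[deprecated Summit.FinalStateConjecture.FinalStateConjecture.Theorems.CaptureSufficesTame.Negative.assembly_iff_captureSufficesTame
  (since := "2026-08-17")]
alias assembly_iff_captureSufficesC2 :=
  Summit.FinalStateConjecture.FinalStateConjecture.Theorems.CaptureSufficesTame.Negative.assembly_iff_captureSufficesTame

/-- **Closing recipe (pre-revision crux)**: a proof of `CaptureSufficesC2` (item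
stmt-FinalStateConjecture-14986, stated over plain censorship `WeakCosmicCensorshipMGHD`) still closes the
re-typed assembly item: the item's tame censorship hypothesis forgets to plain censorship
(`weakCosmicCensorshipMGHD_of_weakCosmicCensorshipTame`). [folklore] -/
theorem assembly_of_captureSufficesC2 (hS : CaptureSufficesC2) : Assembly :=
  fun h ↦ hS h.1 h.2.1 (weakCosmicCensorshipMGHD_of_weakCosmicCensorshipTame h.2.2)

/-- **Deprecated record.** Formerly `Assembly → CaptureSufficesC2` (a proof of the rev-16 item is a proof
of the rev-16 crux); since the tame re-typing a proof of the item is a proof of the TAME crux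
`CaptureSufficesTame` (currying), and the plain-genericity converse is underivable, so the name is kept
as an alias of `PhaseMixingCaptureAssemblyTame.captureSufficesTame_of_assembly`. [folklore] -/
@[deprecated Summit.FinalStateConjecture.FinalStateConjecture.Theorems.PhaseMixingCaptureAssemblyTame.captureSufficesTame_of_assembly
  (since := "2026-08-17")]
alias captureSufficesC2_of_assembly :=
  Summit.FinalStateConjecture.FinalStateConjecture.Theorems.PhaseMixingCaptureAssemblyTame.captureSufficesTame_of_assembly

/-- **Necessity**: the summit statement implies the assembly item (drop the hypotheses). [folklore] -/
theorem assembly_of_finalStateConjecture (h : FinalStateConjecture) : Assembly :=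
  fun _ ↦ h

/-- **Granted the three (re-typed) capture / censorship cruxes, the item is the summit statement**:
under `NearExtremalKappaCapture`, `BulkKerrCaptureC2` and the TAME censorship
`WeakCosmicCensorshipTame`, `Assembly ↔ FinalStateConjecture` (what is left is the whole large-data
front end `CaptureSufficesTame`). [folklore] -/
theorem assembly_iff_statement_of_tameCruxes (h₁ : NearExtremalKappaCapture) (h₂ : BulkKerrCaptureC2)
    (h₃ : WeakCosmicCensorshipTame) : Assembly ↔ FinalStateConjecture :=
  ⟨fun h ↦ h ⟨h₁, h₂, h₃⟩, assembly_of_finalStateConjecture⟩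

/-- **Deprecated record.** Formerly the same equivalence under the PLAIN censorship hypothesis
`WeakCosmicCensorshipMGHD` (rev-16 `Assembly`); since the tame re-typing the item consumes tame
censorship, which plain censorship does not supply, so the name is kept as an alias of
`assembly_iff_statement_of_tameCruxes`. [folklore] -/
@[deprecated assembly_iff_statement_of_tameCruxes (since := "2026-08-17")]
alias assembly_iff_closes_hypothesis := assembly_iff_statement_of_tameCruxes

/-- **The pre-revision front end still gives the summit statement**: the plain-censorship cruxes and the
pre-revision conditional crux `CaptureSufficesC2` yield `FinalStateConjecture` by modus ponens (before the
re-typing this was the route's `closes` factored through `Assembly`; `closes` now runs over the tame pair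
`WeakCosmicCensorshipTame` / `CaptureSufficesTame`). [folklore] -/
theorem finalStateConjecture_of_cruxes (h₁ : NearExtremalKappaCapture) (h₂ : BulkKerrCaptureC2)
    (h₃ : WeakCosmicCensorshipMGHD) (hS : CaptureSufficesC2) : FinalStateConjecture :=
  hS h₁ h₂ h₃

end Summit.FinalStateConjecture.FinalStateConjecture.Theorems.PhaseMixingCaptureAssembly
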